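import Mathlib
import Summits.MatrixMultiplication.MatrixMultiplication.Theorems.SoloInformedValAveragedConstruction

/-!
# Answer to Pratt's Question 4.9 (file 3 of 3): `ℤ_N` and the asymptotic count

K. Pratt, arXiv:2309.03878, §4.1, Question 4.9: "What is the maximum over all `A, B, C ⊆ ℤ_n`
satisfying `E_{a'∈A,b'∈B} #{(a,b,c) ∈ A × B × C : 0 = a'+b+c = a+b'+c} ≤ 1`,
`E_{a'∈A,c'∈C} #{… : 0 = a'+b+c = a+b+c'} ≤ 1`, `E_{b'∈B,c'∈C} #{… : 0 = a+b'+c = a+b+c'} ≤ 1`,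
of the number of solutions to `a + b + c = 0` with `(a,b,c) ∈ A × B × C`?"

**Answer (`pratt_question_4_9`): `n^{3/2 - o(1)}`.**  For every `ε > 0` and all large `N` there are
`A, B, C ⊆ ℤ_N` satisfying all three averaged conditions (`AvgTrapezoidFree`, file 1) with at least
`N^{3/2-ε}` solutions (the proof gives `≥ N^{3/2} e^{-4√(log N)}/512`).  Since the first condition
alone forces `≤ N^{3/2}` solutions (`card_sol_sq_le`, `card_sol_le_rpow` = [Pratt, proof of
Prop. 3.4 / §4.1]: the number of solutions is `Σ_c r(c) ≤ |C|^{1/2} (Σ_c r(c)²)^{1/2}` and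
`Σ_c r(c)² = sumC ≤ |A||B|`), the exponent `3/2` is exact.  So the averaged hypotheses — even all three together — cannot replace the pointwise
ones in any argument towards [Pratt, Thm 1.3 / Cor. 3.6] (`Val(ℤ_n) ≤ n^{1+2ω/9+o(1)}`): an upper
bound below `3/2` must use the pointwise codegree structure.

The sets are Pratt's own Proposition 4.8 example (file 2), planted in `ℤ` and mapped to `ℤ_N`
for `N > 8n²` (no wrap-around: `A ⊆ [0,4n²]`, `C ⊆ [-2n², -1]`), with `S` a Behrend set
(`Behrend.roth_lower_bound` in Mathlib: `rothNumberNat n ≥ n·e^{-4√(log n)}`).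

* `card_sol_sq_le`, `card_sol_le_rpow` — the upper bound `#sol ≤ (#A·#B·#C)^{1/2} ≤ N^{3/2}`
  from the first condition alone;
* `card_sol_ge` — `≥ #S·((h+1)²-1)` planted solutions (`≥ #S·n²/8` for `n ≥ 3`);
* `zmod_instance` — the `ℤ_N` instance for any 3AP-free `S ⊆ {0,…,n-1}`, `8n² < N`;
* `pratt_question_4_9` — the asymptotic statement.

solo-informed MatrixMultiplication, gen 66.
-/

noncomputable section

namespace Summit.MatrixMultiplication.MatrixMultiplication.Theorems.SoloValAvg

open Finset Real

section Planted

variable {n : ℕ} {S : Finset ℕ}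

/-! ### Planted solutions `(xn + y₁) + (xn + y₂) - (2xn + y₁ + y₂) = 0` -/

/-- The offsets `(y₁, y₂) ∈ [0,h]² \ {(0,0)}`. -/
def offsets (n : ℕ) : Finset (ℤ × ℤ) := (Icc (0 : ℤ) (hw n) ×ˢ Icc (0 : ℤ) (hw n)).erase (0, 0)

/-- The planted solution with base `x` and offsets `y`. -/
def plant (n : ℕ) (p : ℕ × ℤ × ℤ) : ℤ × ℤ × ℤ :=
  ((p.1 : ℤ) * n + p.2.1, (p.1 : ℤ) * n + p.2.2, -(2 * (p.1 : ℤ) * n + (p.2.1 + p.2.2)))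

/-- `#offsets = (h+1)² - 1`. -/
theorem card_offsets : #(offsets n) = (hw n + 1) * (hw n + 1) - 1 := by
  rw [offsets, card_erase_of_mem (by simp), card_product, Int.card_Icc]
  simp

/-- Planted triples are solutions. -/
theorem plant_mem_sol (hn : 1 ≤ n) {x : ℕ} (hx : x ∈ S) {y : ℤ × ℤ} (hy : y ∈ offsets n) :
    plant n (x, y) ∈ sol (setA n S) (setA n S) (setC n S) := by
  simp only [offsets, mem_erase, mem_product, mem_Icc, ne_eq, Prod.ext_iff] at hy
  obtain ⟨hne, ⟨h1, h2⟩, h3, h4⟩ := hy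
  have hh : 2 * (hw n : ℤ) + 1 ≤ n := by exact_mod_cast two_hw_add_one_le hn
  simp only [sol, plant, mem_filter, mem_product]
  refine ⟨⟨mem_setA.2 (Or.inr ⟨x, hx, mem_I.2 ⟨by linarith, by linarith⟩⟩),
    mem_setA.2 (Or.inr ⟨x, hx, mem_I.2 ⟨by linarith, by linarith⟩⟩),
    mem_setC.2 ⟨x, hx, mem_J.2 ⟨y.1 + y.2, by omega, by linarith, rfl⟩⟩⟩, by ring⟩

/-- `plant` is injective on `S × offsets`. -/
theorem plant_injOn (hn : 1 ≤ n) : Set.InjOn (plant n) ↑(S ×ˢ offsets n) := by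
  rintro ⟨x, y₁, y₂⟩ h ⟨x', y₁', y₂'⟩ h' e
  simp only [coe_product, Set.mem_prod, mem_coe, offsets, mem_erase, mem_product, mem_Icc] at h h'
  simp only [plant, Prod.mk.injEq] at e
  obtain ⟨e1, e2, -⟩ := e
  have hh : 2 * (hw n : ℤ) + 1 ≤ n := by exact_mod_cast two_hw_add_one_le hn
  have k1 := euclid_unique (n := (n : ℤ)) (q := (x : ℤ)) (q' := (x' : ℤ)) (r := y₁) (r' := y₁')
    (by omega) (by omega) (by omega) (by omega) e1
  have hy2 : y₂ = y₂' := by rw [k1.1] at e2; linarith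
  have hx : x = x' := by exact_mod_cast k1.1
  rw [hx, k1.2, hy2]

/-- **Solution count**: at least `#S · ((h+1)² - 1)` solutions. -/
theorem card_sol_ge (hn : 1 ≤ n) :
    #S * ((hw n + 1) * (hw n + 1) - 1) ≤ #(sol (setA n S) (setA n S) (setC n S)) := by
  rw [← card_offsets (n := n), ← card_product, ← card_image_of_injOn (plant_injOn hn)]
  refine card_le_card fun p hp => ?_
  obtain ⟨⟨x, y⟩, hq, rfl⟩ := mem_image.1 hp
  obtain ⟨hx, hy⟩ := mem_product.1 hq
  exact plant_mem_sol hn hx hy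

/-- Numeric form: for `n ≥ 3`, `(h+1)² - 1 ≥ n²/8`, so `8·#sol ≥ #S·n²`. -/
theorem card_sol_ge' (hn : 3 ≤ n) :
    #S * n ^ 2 ≤ 8 * #(sol (setA n S) (setA n S) (setC n S)) := by
  have h := card_sol_ge (n := n) (S := S) (by omega)
  have hh : n ^ 2 ≤ 8 * ((hw n + 1) * (hw n + 1) - 1) := by
    have h1 : n ≤ 2 * hw n + 2 := by unfold hw; omega
    have h2 : 1 ≤ hw n := by unfold hw; omega
    have h3 : n ^ 2 ≤ (2 * hw n + 2) ^ 2 := Nat.pow_le_pow_left h1 2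
    have h4 : (hw n + 1) * (hw n + 1) - 1 + 1 = (hw n + 1) * (hw n + 1) := by
      have : 1 ≤ (hw n + 1) * (hw n + 1) := Nat.one_le_iff_ne_zero.2 (by positivity)
      omega
    nlinarith
  calc #S * n ^ 2 ≤ #S * (8 * ((hw n + 1) * (hw n + 1) - 1)) := Nat.mul_le_mul_left _ hh
    _ = 8 * (#S * ((hw n + 1) * (hw n + 1) - 1)) := by ring
    _ ≤ 8 * #(sol (setA n S) (setA n S) (setC n S)) := Nat.mul_le_mul_left _ h


end Planted

/-! ### Transport to `ℤ_N` -/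

section ZModInstance

variable {n : ℕ} {S : Finset ℕ}

/-- `A ⊆ [0, 4n²]`. -/
theorem setA_le (hSn : ∀ x ∈ S, x < n) {a : ℤ} (ha : a ∈ setA n S) : a ≤ 4 * (n : ℤ) ^ 2 := by
  rcases mem_setA.1 ha with hp | ⟨x, hx, hax⟩
  · exact (mem_Icc.1 hp).2
  · rw [mem_I] at hax
    have hxn : (x : ℤ) ≤ n - 1 := by have := hSn x hx; omega
    have hh : (hw n : ℤ) ≤ n := by have := two_hw_add_one_le (n := n) (by omega); omega
    have hn0 : (0 : ℤ) ≤ n := by positivity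
    nlinarith [mul_le_mul_of_nonneg_right hxn hn0]

/-- `C ⊆ [-2n², -1]`. -/
theorem setC_bounds (hSn : ∀ x ∈ S, x < n) {c : ℤ} (hc : c ∈ setC n S) :
    -(2 * (n : ℤ) ^ 2) ≤ c ∧ c ≤ -1 := by
  obtain ⟨x, hx, hcx⟩ := mem_setC.1 hc
  obtain ⟨y, hy1, hy2, rfl⟩ := mem_J.1 hcx
  have hxn : (x : ℤ) ≤ n - 1 := by have := hSn x hx; omega
  have hn0 : (0 : ℤ) ≤ n := by positivity
  have hxn0 : (0 : ℤ) ≤ (x : ℤ) * n := by positivity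
  constructor
  · nlinarith [mul_le_mul_of_nonneg_right hxn hn0]
  · linarith

/-- The cast `ℤ → ℤ_N` is injective on any set contained in an interval of length `< N`. -/
theorem castAddHom_injOn {N : ℕ} {T : Finset ℤ} {lo : ℤ} (hT : ∀ t ∈ T, lo ≤ t ∧ t < lo + N) :
    Set.InjOn (Int.castAddHom (ZMod N)) ↑T := by
  intro t ht t' ht' h
  simp only [Int.coe_castAddHom] at h
  have hd := (ZMod.intCast_eq_intCast_iff_dvd_sub t t' N).1 h
  have h1 := hT t ht
  have h2 := hT t' ht'
  have := Int.eq_zero_of_abs_lt_dvd hd (abs_lt.2 ⟨by linarith, by linarith⟩)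
  linarith

variable (hn : 2 ≤ n) (h3 : ThreeAPFree (S : Set ℕ)) (hSn : ∀ x ∈ S, x < n) {N : ℕ}
  (hN : 8 * n ^ 2 < N)
include hn h3 hSn hN

/-- **The `ℤ_N` instance**: for `S ⊆ {0,…,n-1}` 3AP-free and `N > 8n²`, the images of `A = B`, `C`
in `ℤ_N` satisfy all three averaged trapezoid conditions and have `≥ #S·((h+1)²-1)` solutions. -/
theorem zmod_instance :
    AvgTrapezoidFree ((setA n S).image (Int.castAddHom (ZMod N)))
        ((setA n S).image (Int.castAddHom (ZMod N))) ((setC n S).image (Int.castAddHom (ZMod N))) ∧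
      #S * ((hw n + 1) * (hw n + 1) - 1) ≤
        #(sol ((setA n S).image (Int.castAddHom (ZMod N)))
          ((setA n S).image (Int.castAddHom (ZMod N))) ((setC n S).image (Int.castAddHom (ZMod N)))) := by
  have hN' : 8 * (n : ℤ) ^ 2 < N := by exact_mod_cast hN
  have hA : Set.InjOn (Int.castAddHom (ZMod N)) ↑(setA n S) :=
    castAddHom_injOn (lo := 0) fun a ha => ⟨nonneg_of_mem_setA ha, by linarith [setA_le hSn ha]⟩
  have hC : Set.InjOn (Int.castAddHom (ZMod N)) ↑(setC n S) :=
    castAddHom_injOn (lo := -(2 * (n : ℤ) ^ 2)) fun c hc =>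
      ⟨(setC_bounds hSn hc).1, by linarith [(setC_bounds hSn hc).2]⟩
  have hr : ∀ a ∈ setA n S, ∀ b ∈ setA n S, ∀ c ∈ setC n S,
      Int.castAddHom (ZMod N) (a + b + c) = 0 → a + b + c = 0 := by
    intro a ha b hb c hc h
    rw [Int.coe_castAddHom, ZMod.intCast_zmod_eq_zero_iff_dvd] at h
    have := nonneg_of_mem_setA ha; have := nonneg_of_mem_setA hb
    have := setA_le hSn ha; have := setA_le hSn hb
    have := setC_bounds hSn hc
    exact Int.eq_zero_of_abs_lt_dvd h (abs_lt.2 ⟨by linarith, by linarith⟩)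
  refine ⟨avgTrapezoidFree_image _ hA hA hC hr (construction_avgTrapezoidFree hn h3 hSn), ?_⟩
  rw [card_sol_image _ hA hA hC hr]
  exact card_sol_ge (by omega)

end ZModInstance

/-! ### The upper bound from the first averaged condition alone ([Pratt, §4.1]) -/

section UpperBound

variable {G : Type*} [AddCommGroup G] [DecidableEq G]

/-- The number of solutions through a fixed `c`, counted on the `A`-side and on the `B`-side,
is the same (`a ↦ -a - c` is a bijection between the two fibres). -/
theorem card_fibre_eq (A B : Finset G) (c : G) :
    #(A.filter (fun a => -a - c ∈ B)) = #(B.filter (fun b => -b - c ∈ A)) := by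
  refine card_nbij' (fun a => -a - c) (fun b => -b - c) ?_ ?_ ?_ ?_
  · intro a ha
    rw [mem_coe, mem_filter] at ha ⊢
    exact ⟨ha.2, by rw [show -(-a - c) - c = a by abel]; exact ha.1⟩
  · intro b hb
    rw [mem_coe, mem_filter] at hb ⊢
    exact ⟨hb.2, by rw [show -(-b - c) - c = b by abel]; exact hb.1⟩
  · intro a _; show -(-a - c) - c = a; abel
  · intro b _; show -(-b - c) - c = b; abel

/-- `#sol = Σ_{c∈C} r(c)` with `r(c) = #{a ∈ A : -a-c ∈ B}` the number of solutions through `c`. -/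
theorem card_sol_eq_sum (A B C : Finset G) :
    #(sol A B C) = ∑ c ∈ C, #(A.filter (fun a => -a - c ∈ B)) := by
  rw [sol, card_eq_sum_card_fiberwise (t := C) (f := fun p : G × G × G => p.2.2)
    (fun p hp => by
      have h := (mem_filter.1 (mem_coe.1 hp)).1
      simp only [mem_product] at h
      exact mem_coe.2 h.2.2)]
  refine sum_congr rfl fun c hc => ?_
  rw [← card_image_of_injective (A.filter (fun a => -a - c ∈ B))
    (f := fun a : G => (a, -a - c, c)) (by intro a₁ a₂ h; exact congrArg Prod.fst h)]
  congr 1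
  ext ⟨a, b, c'⟩
  simp only [mem_filter, mem_product, mem_image, Prod.mk.injEq]
  constructor
  · rintro ⟨⟨⟨ha, hb, -⟩, hsum⟩, hcc⟩
    subst hcc
    have hb' := eq_neg_sub_of_add_add_eq_zero hsum
    exact ⟨a, ⟨ha, hb' ▸ hb⟩, rfl, hb'.symm, rfl⟩
  · rintro ⟨a₀, ⟨ha₀, hb₀⟩, rfl, rfl, rfl⟩
    exact ⟨⟨⟨ha₀, hb₀, hc⟩, by abel⟩, rfl⟩

/-- [Pratt, §4.1, before Prop. 4.8]: the FIRST averaged condition alone gives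
`#sol² ≤ #A·#B·#C`, by `sumC = Σ_c r(c)²` (`sumC_eq`, `card_fibre_eq`) and Cauchy–Schwarz —
this is the proof of the `|G|^{3/2}` bound of [Pratt, Prop. 3.4]. -/
theorem card_sol_sq_le (A B C : Finset G) (h : sumC A B C ≤ #A * #B) :
    #(sol A B C) ^ 2 ≤ #A * #B * #C := by
  rw [card_sol_eq_sum]
  calc (∑ c ∈ C, #(A.filter (fun a => -a - c ∈ B))) ^ 2
      ≤ #C * ∑ c ∈ C, #(A.filter (fun a => -a - c ∈ B)) ^ 2 := sq_sum_le_card_mul_sum_sq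
    _ = #C * sumC A B C := by
        rw [sumC_eq]
        congr 1
        refine sum_congr rfl fun c _ => ?_
        rw [sq, ← card_fibre_eq]
    _ ≤ #C * (#A * #B) := Nat.mul_le_mul_left _ h
    _ = #A * #B * #C := by ring

/-- Upper half of the answer to Question 4.9: in `ℤ_N` a triple satisfying just the first averaged
condition has at most `N^{3/2}` solutions. -/
theorem card_sol_le_rpow {N : ℕ} [NeZero N] (A B C : Finset (ZMod N))
    (h : sumC A B C ≤ #A * #B) : (#(sol A B C) : ℝ) ≤ (N : ℝ) ^ (3 / 2 : ℝ) := by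
  have hA : #A ≤ N := (card_le_univ A).trans_eq (ZMod.card N)
  have hB : #B ≤ N := (card_le_univ B).trans_eq (ZMod.card N)
  have hC : #C ≤ N := (card_le_univ C).trans_eq (ZMod.card N)
  have h1 : #(sol A B C) ^ 2 ≤ N ^ 3 :=
    calc #(sol A B C) ^ 2 ≤ #A * #B * #C := card_sol_sq_le A B C h
      _ ≤ N * N * N := by gcongr
      _ = N ^ 3 := by ring
  have h1' : ((#(sol A B C) : ℝ) ^ 2) ≤ (N : ℝ) ^ 3 := by exact_mod_cast h1
  have h0 : (0 : ℝ) ≤ #(sol A B C) := by positivity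
  calc (#(sol A B C) : ℝ) = (((#(sol A B C) : ℝ)) ^ 2) ^ (1 / 2 : ℝ) := by
        rw [← Real.sqrt_eq_rpow, Real.sqrt_sq h0]
    _ ≤ ((N : ℝ) ^ 3) ^ (1 / 2 : ℝ) := Real.rpow_le_rpow (by positivity) h1' (by norm_num)
    _ = (N : ℝ) ^ (3 / 2 : ℝ) := by
        rw [← Real.rpow_natCast, ← Real.rpow_mul (by positivity)]
        norm_num

end UpperBound

/-! ### The asymptotic answer -/

section Answer

/-- Elementary: from `n = ⌊√(N/9)⌋` and `N ≥ 576`: `4 ≤ n`, `9n² ≤ N ≤ 16n²`. -/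
theorem sqrt_facts {N : ℕ} (hN : 576 ≤ N) :
    4 ≤ Nat.sqrt (N / 9) ∧ 9 * Nat.sqrt (N / 9) ^ 2 ≤ N ∧ N ≤ 16 * Nat.sqrt (N / 9) ^ 2 := by
  set n := Nat.sqrt (N / 9) with hn
  have h1 : n ^ 2 ≤ N / 9 := Nat.sqrt_le' (N / 9)
  have h2 : N / 9 < (n + 1) ^ 2 := Nat.lt_succ_sqrt' (N / 9)
  have h3 : 9 * (N / 9) ≤ N := Nat.mul_div_le N 9
  have h4 : N < 9 * (N / 9) + 9 := by omega
  have hn4 : 4 ≤ n := by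
    by_contra hlt
    have : (n + 1) ^ 2 ≤ 25 := by nlinarith
    omega
  refine ⟨hn4, by omega, ?_⟩
  nlinarith

/-- The real-analysis tail: for `L ≥ 64/ε²`, `4√L ≤ εL/2`. -/
theorem tail_ineq {ε L : ℝ} (hε : 0 < ε) (hL : 64 / ε ^ 2 ≤ L) : 4 * √L ≤ ε * L / 2 := by
  have hL0 : 0 ≤ L := le_trans (by positivity) hL
  have h8 : 8 / ε ≤ √L := by
    rw [← Real.sqrt_sq (by positivity : (0 : ℝ) ≤ 8 / ε)]
    exact Real.sqrt_le_sqrt (by rw [div_pow]; norm_num; exact hL)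
  have h8' : 8 ≤ √L * ε := (div_le_iff₀ hε).1 h8
  nlinarith [Real.mul_self_sqrt hL0, Real.sqrt_nonneg L]

/-- **Answer to [Pratt, arXiv:2309.03878, Question 4.9]: the maximum is `N^{3/2-o(1)}`.**
For every `ε > 0` and all sufficiently large `N` there are `A, B, C ⊆ ℤ_N` satisfying all three
averaged equilateral-trapezoid conditions with at least `N^{3/2-ε}` solutions of `a + b + c = 0`.
(The first condition alone caps the count at `N^{3/2}` by Cauchy–Schwarz.) -/
theorem pratt_question_4_9 (ε : ℝ) (hε : 0 < ε) :
    ∃ N₀ : ℕ, ∀ N : ℕ, N₀ ≤ N → ∃ A B C : Finset (ZMod N),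
      AvgTrapezoidFree A B C ∧ (N : ℝ) ^ (3 / 2 - ε) ≤ #(sol A B C) := by
  refine ⟨max 576 (max ⌈Real.exp (64 / ε ^ 2)⌉₊ ⌈(512 : ℝ) ^ (2 / ε)⌉₊), fun N hN => ?_⟩
  have hN576 : 576 ≤ N := le_trans (le_max_left _ _) hN
  have hNexp : Real.exp (64 / ε ^ 2) ≤ N :=
    le_trans (Nat.le_ceil _) (by exact_mod_cast le_trans (le_max_left _ _) (le_trans (le_max_right _ _) hN))
  have hN512 : (512 : ℝ) ^ (2 / ε) ≤ N :=
    le_trans (Nat.le_ceil _) (by exact_mod_cast le_trans (le_max_right _ _) (le_trans (le_max_right _ _) hN))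
  -- the parameters
  obtain ⟨hn4, h9, h16⟩ := sqrt_facts hN576
  set n := Nat.sqrt (N / 9) with hn
  obtain ⟨S, hSr, hScard, hS3⟩ := rothNumberNat_spec n
  have hSn : ∀ x ∈ S, x < n := fun x hx => mem_range.1 (hSr hx)
  have h8N : 8 * n ^ 2 < N := by nlinarith
  obtain ⟨hfree, hsol⟩ := zmod_instance (n := n) (S := S) (by omega) hS3 hSn h8N
  refine ⟨_, _, _, hfree, ?_⟩
  -- real-number bookkeeping
  set M := #(sol ((setA n S).image (Int.castAddHom (ZMod N)))
    ((setA n S).image (Int.castAddHom (ZMod N))) ((setC n S).image (Int.castAddHom (ZMod N))))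
  have hsol' : #S * n ^ 2 ≤ 8 * M := by
    have hh : n ^ 2 ≤ 8 * ((hw n + 1) * (hw n + 1) - 1) := by
      have h1 : n ≤ 2 * hw n + 2 := by unfold hw; omega
      have h2 : 1 ≤ hw n := by unfold hw; omega
      have h3 : n ^ 2 ≤ (2 * hw n + 2) ^ 2 := Nat.pow_le_pow_left h1 2
      have h4 : (hw n + 1) * (hw n + 1) - 1 + 1 = (hw n + 1) * (hw n + 1) := by
        have : 1 ≤ (hw n + 1) * (hw n + 1) := Nat.one_le_iff_ne_zero.2 (by positivity)
        omega
      nlinarith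
    calc #S * n ^ 2 ≤ #S * (8 * ((hw n + 1) * (hw n + 1) - 1)) := Nat.mul_le_mul_left _ hh
      _ = 8 * (#S * ((hw n + 1) * (hw n + 1) - 1)) := by ring
      _ ≤ 8 * M := Nat.mul_le_mul_left _ hsol
  have hNpos : (0 : ℝ) < N := by exact_mod_cast (show 0 < N by omega)
  have hnpos : (0 : ℝ) < n := by exact_mod_cast (show 0 < n by omega)
  have hnN : (n : ℝ) ≤ N := by exact_mod_cast (show n ≤ N by nlinarith)
  set L := Real.log N with hL
  have hL64 : 64 / ε ^ 2 ≤ L := (Real.le_log_iff_exp_le hNpos).2 hNexp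
  have hL0 : 0 ≤ L := le_trans (by positivity) hL64
  -- Behrend
  have hBeh : (n : ℝ) * Real.exp (-4 * √(Real.log n)) ≤ #S := by
    rw [hScard]; exact Behrend.roth_lower_bound
  have hexp : Real.exp (-4 * √L) ≤ Real.exp (-4 * √(Real.log n)) := by
    rw [Real.exp_le_exp]
    have : √(Real.log n) ≤ √L := Real.sqrt_le_sqrt (Real.log_le_log hnpos hnN)
    linarith
  -- n ≥ √N / 4
  have hsqrt : √(N : ℝ) ≤ 4 * n := by
    rw [Real.sqrt_le_left (by positivity)]
    exact_mod_cast (show N ≤ (4 * n) ^ 2 by nlinarith)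
  -- the main chain: N √N e^{-4√L} ≤ 512 M
  have hchain : (N : ℝ) * √(N : ℝ) * Real.exp (-4 * √L) ≤ 512 * M := by
    have e1 : (N : ℝ) * √(N : ℝ) ≤ 64 * (n : ℝ) ^ 3 := by
      have : (N : ℝ) ≤ 16 * (n : ℝ) ^ 2 := by exact_mod_cast h16
      nlinarith [Real.sqrt_nonneg (N : ℝ)]
    have e2 : (#S : ℝ) * (n : ℝ) ^ 2 ≤ 8 * M := by exact_mod_cast hsol'
    have e3 : (n : ℝ) * Real.exp (-4 * √L) ≤ #S := le_trans (by gcongr) hBeh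
    calc (N : ℝ) * √(N : ℝ) * Real.exp (-4 * √L)
        ≤ 64 * (n : ℝ) ^ 3 * Real.exp (-4 * √L) := by gcongr
      _ = 64 * (n : ℝ) ^ 2 * ((n : ℝ) * Real.exp (-4 * √L)) := by ring
      _ ≤ 64 * (n : ℝ) ^ 2 * #S := by gcongr
      _ = 64 * ((#S : ℝ) * (n : ℝ) ^ 2) := by ring
      _ ≤ 64 * (8 * M) := by gcongr
      _ = 512 * M := by ring
  -- N^ε ≥ 512 e^{4√L}
  have hpow : 512 * Real.exp (4 * √L) ≤ (N : ℝ) ^ ε := by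
    have hhalf1 : (512 : ℝ) ≤ (N : ℝ) ^ (ε / 2) := by
      have := Real.rpow_le_rpow (by positivity) hN512 (by positivity : (0 : ℝ) ≤ ε / 2)
      rwa [← Real.rpow_mul (by norm_num), show (2 / ε) * (ε / 2) = (1 : ℝ) by field_simp,
        Real.rpow_one] at this
    have hhalf2 : Real.exp (4 * √L) ≤ (N : ℝ) ^ (ε / 2) := by
      rw [Real.rpow_def_of_pos hNpos, Real.exp_le_exp]
      have := tail_ineq hε hL64
      rw [← hL]; linarith
    calc 512 * Real.exp (4 * √L) ≤ (N : ℝ) ^ (ε / 2) * (N : ℝ) ^ (ε / 2) :=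
          mul_le_mul hhalf1 hhalf2 (by positivity) (by positivity)
      _ = (N : ℝ) ^ ε := by rw [← Real.rpow_add hNpos]; ring_nf
  -- conclude
  have hsplit : (N : ℝ) ^ (3 / 2 - ε) = (N : ℝ) * √(N : ℝ) / (N : ℝ) ^ ε := by
    rw [Real.rpow_sub hNpos, show (3 / 2 : ℝ) = 1 + 1 / 2 by norm_num, Real.rpow_add hNpos,
      Real.rpow_one, ← Real.sqrt_eq_rpow]
  rw [hsplit]
  have hE : 0 < 512 * Real.exp (4 * √L) := by positivity
  calc (N : ℝ) * √(N : ℝ) / (N : ℝ) ^ ε ≤ (N : ℝ) * √(N : ℝ) / (512 * Real.exp (4 * √L)) :=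
        div_le_div_of_nonneg_left (by positivity) hE hpow
    _ = (N : ℝ) * √(N : ℝ) * Real.exp (-4 * √L) / 512 := by
        have hneg : Real.exp (-4 * √L) = (Real.exp (4 * √L))⁻¹ := by
          rw [← Real.exp_neg, neg_mul]
        rw [hneg]; field_simp
    _ ≤ M := by linarith [hchain]

end Answer

end Summit.MatrixMultiplication.MatrixMultiplication.Theorems.SoloValAvg

end
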